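import Summits.ValiantsHypothesis.ValiantsHypothesis.Theorems.BarrierLeverAnchoredDoorHitsLowerPairsApexRecursion

/-!
# Support item `AnchoredDoorHitsLowerPairs` (stmt-ValiantsHypothesis-22510), line `anchored-peeling`:
# DOUBLE BALLS ARE APEX-DECOMPOSABLE — the cube `2^X` versus `B(V, ≤a) ∪ c∗B(V, ≤b)` (`a + b + 1 = |V| = |X|`) is hit at profile 1

Helper file (`--supports stmt-ValiantsHypothesis-22510`; cell valiant-natproofs, rung V4, 𝒟-side door (c); registered line
`Cruxes/AnchoredDoorHitsLowerPairs/Lines/anchored_peeling.lean`; prover seat val-np-p1 gen 21; memo HOME/val-np-p1/g21/MEMO-conjM-LT-valnp1-g21.md §9).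
Closes NO item.

THE FAMILY. For a vertex set `V`, an extra vertex `c ∉ V` and `b ≤ a` with `a + b + 1 = |V|`, the DOUBLE BALL `dballF V c a b = B(V, ≤a) ∪ c ∗ B(V, ≤b)` is a
simplicial complex on `|V| + 1` vertices with `2^{|V|}` faces; `b = a − 1` gives the balls `B(2k+1, ≤k)` (branch (i)'s exact family, the Lefschetz member
p582944), `a = b` the cones over them. THEOREM `apexDecomp_dballF`: every double ball is apex-decomposable (`ApexDecomp X (dballF V c a b)` for `|X| = |V|`),
by the uniform move «apex = a vertex `x ∈ V` (door `x_n`), tail set `{c}`»: the link of `x` has co-size `C(|V|−1, a)`, exactly the number of faces `c ∪ W'`,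
`|W'| = b`, `W' ⊆ V∖x`, and the two halves are the double balls `dballF (V∖x) c a (b−1)` (a cube when `b = 0`) and `dballF (V∖x) c (a−1) b`; the cone case
`a = b` peels `c`. Also `apexDecomp_powerset` (cubes). COROLLARY `symbolicDet_one_ne_zero_dballF`: the cube rows `2^X` against the columns of a double ball
are hit at profile 1 (via `symbolicDet_one_ne_zero_of_apexDecomp`) — a Lefschetz-free kernel proof for the cube-versus-ball pairs and their two-layer relatives.

WHAT THIS IS NOT: perturbed balls (the conjectured residual members) are apex-decomposable in every test (memo §9) but are not treated here; nothing on crux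
stmt-ValiantsHypothesis-14610 or on `VP` versus `VNP`.
-/

set_option linter.dupNamespace false

namespace Summit.ValiantsHypothesis.ValiantsHypothesis.Theorems.BarrierLever.AnchoredPeeling

open Finset MvPolynomial

noncomputable section

variable {h : ℕ}

/-! ## 1. Balls, double balls, and their bookkeeping -/

/-- `B(V, ≤a)`: the subsets of `V` with at most `a` elements. -/
def ballF (V : Finset (Fin h)) (a : ℕ) : Finset (Finset (Fin h)) := V.powerset.filter (fun W => W.card ≤ a)

/-- The double ball `B(V, ≤a) ∪ c ∗ B(V, ≤b)`. -/
def dballF (V : Finset (Fin h)) (c : Fin h) (a b : ℕ) : Finset (Finset (Fin h)) := ballF V a ∪ (ballF V b).image (insert c)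

/-- Membership in `B(V, ≤a)`. -/
theorem mem_ballF {V : Finset (Fin h)} {a : ℕ} {W : Finset (Fin h)} : W ∈ ballF V a ↔ W ⊆ V ∧ W.card ≤ a := by
  rw [ballF, Finset.mem_filter, Finset.mem_powerset]

/-- Membership in the double ball (`c ∉ V`). -/
theorem mem_dballF {V : Finset (Fin h)} {c : Fin h} {a b : ℕ} (hc : c ∉ V) {W : Finset (Fin h)} :
    W ∈ dballF V c a b ↔ (W ⊆ V ∧ W.card ≤ a) ∨ (c ∈ W ∧ W.erase c ⊆ V ∧ (W.erase c).card ≤ b) := by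
  rw [dballF, Finset.mem_union, mem_ballF, Finset.mem_image]
  constructor
  · rintro (h1 | ⟨W', hW', rfl⟩)
    · exact Or.inl h1
    · right
      have hcW' : c ∉ W' := fun hmem => hc ((mem_ballF.mp hW').1 hmem)
      rw [Finset.erase_insert hcW']
      exact ⟨Finset.mem_insert_self c W', (mem_ballF.mp hW').1, (mem_ballF.mp hW').2⟩
  · rintro (h1 | ⟨hcW, hsub, hcard⟩)
    · exact Or.inl h1
    · exact Or.inr ⟨W.erase c, mem_ballF.mpr ⟨hsub, hcard⟩, Finset.insert_erase hcW⟩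

/-- A face of the double ball avoids `c` iff it lies in the `V`-part. -/
theorem mem_dballF_of_notMem {V : Finset (Fin h)} {c : Fin h} {a b : ℕ} (hc : c ∉ V) {W : Finset (Fin h)} (hcW : c ∉ W) :
    W ∈ dballF V c a b ↔ W ⊆ V ∧ W.card ≤ a := by
  rw [mem_dballF hc]
  exact ⟨fun h' => h'.elim id (fun h2 => absurd h2.1 hcW), Or.inl⟩

/-- A face of the double ball through `c`. -/
theorem mem_dballF_of_mem {V : Finset (Fin h)} {c : Fin h} {a b : ℕ} (hc : c ∉ V) {W : Finset (Fin h)} (hcW : c ∈ W) :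
    W ∈ dballF V c a b ↔ W.erase c ⊆ V ∧ (W.erase c).card ≤ b := by
  rw [mem_dballF hc]
  constructor
  · rintro (⟨hsub, -⟩ | ⟨-, h2⟩)
    · exact absurd (hsub hcW) hc
    · exact h2
  · exact fun h2 => Or.inr ⟨hcW, h2⟩

/-- `Σ_{γ ∈ Y} tailInd ∅ γ = 0`. -/
theorem sum_tailInd_empty (Y : Finset (Fin h)) : ∑ γ ∈ Y, tailInd (∅ : Finset (Fin h)) γ = 0 := by
  simp [tailInd]

/-- `Σ_{γ ∈ Y} tailInd {c} γ = [c ∈ Y]`. -/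
theorem sum_tailInd_singleton (c : Fin h) (Y : Finset (Fin h)) : ∑ γ ∈ Y, tailInd ({c} : Finset (Fin h)) γ = if c ∈ Y then 1 else 0 := by
  classical
  simp only [tailInd, Finset.mem_singleton]
  rw [Finset.sum_ite_eq' Y c (fun _ => (1 : ℂ))]

/-! ## 2. Cubes are apex-decomposable -/

/-- The power set of `V` is apex-decomposable over any `X` with `|X| = |V|` (peel cones). -/
theorem apexDecomp_powerset : ∀ (m : ℕ) (V X : Finset (Fin h)), V.card = m → X.card = m → ApexDecomp X V.powerset := by
  classical
  intro m
  induction m with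
  | zero =>
    intro V X hV hX
    rw [Finset.card_eq_zero.mp hV, Finset.card_eq_zero.mp hX, Finset.powerset_empty]
    exact ApexDecomp.base
  | succ m ih =>
    intro V X hV hX
    obtain ⟨x, hx⟩ := Finset.card_pos.mp (by rw [hV]; exact Nat.succ_pos m)
    obtain ⟨n, hn⟩ := Finset.card_pos.mp (by rw [hX]; exact Nat.succ_pos m)
    have hV' : (V.erase x).card = m := by rw [Finset.card_erase_of_mem hx, hV]; rfl
    have hX' : (X.erase n).card = m := by rw [Finset.card_erase_of_mem hn, hX]; rfl
    have hsub := ih (V.erase x) (X.erase n) hV' hX'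
    rw [← Finset.insert_erase hn]
    have hfilt : V.powerset.filter (fun W => x ∉ W) = (V.erase x).powerset := by
      ext W
      simp only [Finset.mem_filter, Finset.mem_powerset, Finset.subset_erase]
    have himg : (V.powerset.filter (fun W => x ∈ W)).image (fun W => W.erase x) = (V.erase x).powerset := by
      ext W
      simp only [Finset.mem_image, Finset.mem_filter, Finset.mem_powerset]
      constructor
      · rintro ⟨W', ⟨hW'V, -⟩, rfl⟩
        exact Finset.erase_subset_erase x hW'V
      · intro hW
        rw [Finset.subset_erase] at hW
        refine ⟨insert x W, ⟨Finset.insert_subset hx hW.1, Finset.mem_insert_self x W⟩, Finset.erase_insert hW.2⟩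
    refine ApexDecomp.step (vs := x) (G₁ := ∅) (T := ∅) (Finset.notMem_erase n X) (fun Y hY => absurd hY (Finset.notMem_empty Y))
      (fun Y hY => absurd hY (Finset.notMem_empty Y)) (fun Y hY => absurd hY (Finset.notMem_empty Y))
      (fun Y _ _ hne => absurd (sum_tailInd_empty Y) hne) ?_ ?_
    · rw [hfilt, Finset.sdiff_empty]; exact hsub
    · rw [himg, Finset.union_empty]; exact hsub

/-! ## 3. Double balls are apex-decomposable -/

/-- `B(V, ≤a) = B(V∖x, ≤a) ∪ x ∗ B(V∖x, ≤a−1)` for `x ∈ V`, `1 ≤ a`. -/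
theorem ballF_eq_dballF {V : Finset (Fin h)} {x : Fin h} (hx : x ∈ V) {a : ℕ} (ha : 1 ≤ a) :
    ballF V a = dballF (V.erase x) x a (a - 1) := by
  classical
  ext W
  have hxe : x ∉ V.erase x := Finset.notMem_erase x V
  by_cases hxW : x ∈ W
  · rw [mem_ballF, mem_dballF_of_mem hxe hxW]
    constructor
    · rintro ⟨hsub, hcard⟩
      refine ⟨Finset.erase_subset_erase x hsub, ?_⟩
      rw [Finset.card_erase_of_mem hxW]; omega
    · rintro ⟨hsub, hcard⟩
      refine ⟨fun y hy => ?_, ?_⟩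
      · by_cases hyx : y = x
        · rw [hyx]; exact hx
        · exact Finset.mem_of_mem_erase (hsub (Finset.mem_erase.mpr ⟨hyx, hy⟩))
      · rw [Finset.card_erase_of_mem hxW] at hcard; omega
  · rw [mem_ballF, mem_dballF_of_notMem hxe hxW]
    constructor
    · rintro ⟨hsub, hcard⟩; exact ⟨Finset.subset_erase.mpr ⟨hsub, hxW⟩, hcard⟩
    · rintro ⟨hsub, hcard⟩; exact ⟨(Finset.subset_erase.mp hsub).1, hcard⟩

/-- **Double balls are apex-decomposable.** -/
theorem apexDecomp_dballF : ∀ (m : ℕ) (V X : Finset (Fin h)) (c : Fin h) (a b : ℕ),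
    c ∉ V → V.card = m → X.card = m → a + b + 1 = m → b ≤ a → ApexDecomp X (dballF V c a b) := by
  classical
  intro m
  induction m with
  | zero => intro V X c a b _ _ _ hab _; omega
  | succ m ih =>
    intro V X c a b hc hV hX hab hba
    obtain ⟨n, hn⟩ := Finset.card_pos.mp (by rw [hX]; exact Nat.succ_pos m)
    have hX' : (X.erase n).card = m := by rw [Finset.card_erase_of_mem hn, hX]; rfl
    rw [← Finset.insert_erase hn]
    by_cases hcase : b = a
    · ----------------------------------------------------------------- cone case: peel `c`
      subst hcase
      have hfilt : (dballF V c b b).filter (fun W => c ∉ W) = ballF V b := by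
        ext W
        rw [Finset.mem_filter]
        constructor
        · rintro ⟨hW, hcW⟩; exact mem_ballF.mpr ((mem_dballF_of_notMem hc hcW).mp hW)
        · intro hW
          have hcW : c ∉ W := fun hmem => hc ((mem_ballF.mp hW).1 hmem)
          exact ⟨(mem_dballF_of_notMem hc hcW).mpr (mem_ballF.mp hW), hcW⟩
      have himg : ((dballF V c b b).filter (fun W => c ∈ W)).image (fun W => W.erase c) = ballF V b := by
        ext W
        rw [Finset.mem_image]
        constructor
        · rintro ⟨W', hW', rfl⟩
          rw [Finset.mem_filter] at hW'
          exact mem_ballF.mpr ((mem_dballF_of_mem hc hW'.2).mp hW'.1)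
        · intro hW
          have hcW : c ∉ W := fun hmem => hc ((mem_ballF.mp hW).1 hmem)
          refine ⟨insert c W, Finset.mem_filter.mpr ⟨?_, Finset.mem_insert_self c W⟩, Finset.erase_insert hcW⟩
          rw [mem_dballF_of_mem hc (Finset.mem_insert_self c W), Finset.erase_insert hcW]
          exact mem_ballF.mp hW
      -- the half `B(V, ≤b)` is apex-decomposable: a smaller double ball (or `{∅}`)
      have hhalf : ApexDecomp (X.erase n) (ballF V b) := by
        by_cases hb0 : b = 0
        · subst hb0
          have hm : m = 0 := by omega
          rw [hm] at hX'
          have hV1 : ballF V 0 = {∅} := by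
            ext W
            rw [mem_ballF, Finset.mem_singleton, Nat.le_zero, Finset.card_eq_zero]
            exact ⟨fun h' => h'.2, fun h' => ⟨h' ▸ Finset.empty_subset V, h'⟩⟩
          rw [Finset.card_eq_zero.mp hX', hV1]
          exact ApexDecomp.base
        · obtain ⟨x, hx⟩ := Finset.card_pos.mp (by rw [hV]; exact Nat.succ_pos m)
          have hV' : (V.erase x).card = m := by rw [Finset.card_erase_of_mem hx, hV]; rfl
          rw [ballF_eq_dballF hx (Nat.one_le_iff_ne_zero.mpr hb0)]
          exact ih (V.erase x) (X.erase n) x b (b - 1) (Finset.notMem_erase x V) hV' hX' (by omega) (by omega)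
      refine ApexDecomp.step (vs := c) (G₁ := ∅) (T := ∅) (Finset.notMem_erase n X) (fun Y hY => absurd hY (Finset.notMem_empty Y))
        (fun Y hY => absurd hY (Finset.notMem_empty Y)) (fun Y hY => absurd hY (Finset.notMem_empty Y))
        (fun Y _ _ hne => absurd (sum_tailInd_empty Y) hne) ?_ ?_
      · rw [hfilt, Finset.sdiff_empty]; exact hhalf
      · rw [himg, Finset.union_empty]; exact hhalf
    · ----------------------------------------------------------------- Move A: apex `x ∈ V`, tail set `{c}`
      have hba' : b < a := lt_of_le_of_ne hba hcase
      obtain ⟨x, hx⟩ := Finset.card_pos.mp (by rw [hV]; exact Nat.succ_pos m)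
      have hV' : (V.erase x).card = m := by rw [Finset.card_erase_of_mem hx, hV]; rfl
      have hxc : x ≠ c := fun heq => hc (heq ▸ hx)
      have hcV' : c ∉ V.erase x := fun hmem => hc (Finset.mem_of_mem_erase hmem)
      set F := dballF V c a b with hF
      set T := (((V.erase x).powerset).filter (fun W => W.card = b)).image (insert c) with hT
      have hTmem : ∀ Y, Y ∈ T ↔ c ∈ Y ∧ Y.erase c ⊆ V.erase x ∧ (Y.erase c).card = b := by
        intro Y
        rw [hT, Finset.mem_image]
        constructor
        · rintro ⟨W', hW', rfl⟩
          rw [Finset.mem_filter, Finset.mem_powerset] at hW'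
          have hcW' : c ∉ W' := fun hmem => hcV' (hW'.1 hmem)
          rw [Finset.erase_insert hcW']
          exact ⟨Finset.mem_insert_self c W', hW'.1, hW'.2⟩
        · rintro ⟨hcY, hsub, hcard⟩
          exact ⟨Y.erase c, Finset.mem_filter.mpr ⟨Finset.mem_powerset.mpr hsub, hcard⟩, Finset.insert_erase hcY⟩
      -- hypotheses of the step
      have hTF : ∀ Y ∈ T, Y ∈ F ∧ x ∉ Y := by
        intro Y hY
        obtain ⟨hcY, hsub, hcard⟩ := (hTmem Y).mp hY
        refine ⟨(mem_dballF_of_mem hc hcY).mpr ⟨fun y hy => Finset.mem_of_mem_erase (hsub hy), hcard.le⟩, fun hxY => ?_⟩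
        exact Finset.notMem_erase x V (hsub (Finset.mem_erase.mpr ⟨hxc, hxY⟩))
      have hTG : ∀ Y ∈ T, (∑ γ ∈ Y, tailInd ({c} : Finset (Fin h)) γ) ≠ 0 := by
        intro Y hY
        rw [sum_tailInd_singleton, if_pos ((hTmem Y).mp hY).1]; exact one_ne_zero
      have hTL : ∀ Y ∈ T, insert x Y ∉ F := by
        intro Y hY hYF
        obtain ⟨hcY, hsub, hcard⟩ := (hTmem Y).mp hY
        have hcxY : c ∈ insert x Y := Finset.mem_insert_of_mem hcY
        obtain ⟨-, hcard'⟩ := (mem_dballF_of_mem hc hcxY).mp hYF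
        have hxY : x ∉ Y := (hTF Y hY).2
        rw [Finset.erase_insert_of_ne hxc, Finset.card_insert_of_notMem (fun hmem => hxY (Finset.mem_of_mem_erase hmem)), hcard] at hcard'
        omega
      have hcov : ∀ Y ∈ F, x ∉ Y → (∑ γ ∈ Y, tailInd ({c} : Finset (Fin h)) γ) ≠ 0 → Y ∈ T ∨ insert x Y ∈ F := by
        intro Y hYF hxY hne
        rw [sum_tailInd_singleton] at hne
        have hcY : c ∈ Y := by by_contra hcY; rw [if_neg hcY] at hne; exact hne rfl
        obtain ⟨hsub, hcard⟩ := (mem_dballF_of_mem hc hcY).mp hYF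
        have hsub' : Y.erase c ⊆ V.erase x := fun y hy =>
          Finset.mem_erase.mpr ⟨fun heq => hxY (heq ▸ Finset.mem_of_mem_erase hy), hsub hy⟩
        by_cases hcb : (Y.erase c).card = b
        · exact Or.inl ((hTmem Y).mpr ⟨hcY, hsub', hcb⟩)
        · right
          rw [hF, mem_dballF_of_mem hc (Finset.mem_insert_of_mem hcY), Finset.erase_insert_of_ne hxc,
            Finset.card_insert_of_notMem (fun hmem => hxY (Finset.mem_of_mem_erase hmem))]
          exact ⟨Finset.insert_subset hx hsub, by omega⟩
      -- the two halves
      have h0fam : (F.filter (fun W => x ∉ W)) \ T = if b = 0 then (V.erase x).powerset else dballF (V.erase x) c a (b - 1) := by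
        ext W
        rw [Finset.mem_sdiff, Finset.mem_filter, hF]
        by_cases hcW : c ∈ W
        · rw [mem_dballF_of_mem hc hcW, hTmem]
          split_ifs with hb0
          · rw [Finset.mem_powerset]
            constructor
            · rintro ⟨⟨⟨hsub, hcard⟩, hxW⟩, hnT⟩
              exfalso; apply hnT
              refine ⟨hcW, fun y hy => Finset.mem_erase.mpr ⟨fun heq => hxW (heq ▸ Finset.mem_of_mem_erase hy), hsub hy⟩, by omega⟩
            · intro hsub; exact absurd (Finset.mem_of_mem_erase (hsub hcW)) hc
          · rw [mem_dballF_of_mem hcV' hcW]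
            constructor
            · rintro ⟨⟨⟨hsub, hcard⟩, hxW⟩, hnT⟩
              have hsub' : W.erase c ⊆ V.erase x := fun y hy =>
                Finset.mem_erase.mpr ⟨fun heq => hxW (heq ▸ Finset.mem_of_mem_erase hy), hsub hy⟩
              refine ⟨hsub', ?_⟩
              have : (W.erase c).card ≠ b := fun heq => hnT ⟨hcW, hsub', heq⟩
              omega
            · rintro ⟨hsub, hcard⟩
              refine ⟨⟨⟨fun y hy => Finset.mem_of_mem_erase (hsub hy), by omega⟩, fun hxW => Finset.notMem_erase x V (hsub (Finset.mem_erase.mpr ⟨hxc, hxW⟩))⟩, ?_⟩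
              rintro ⟨-, -, hcard'⟩; omega
        · rw [mem_dballF_of_notMem hc hcW]
          have hnT : ¬ (c ∈ W ∧ W.erase c ⊆ V.erase x ∧ (W.erase c).card = b) := fun h' => hcW h'.1
          split_ifs with hb0
          · rw [Finset.mem_powerset]
            constructor
            · rintro ⟨⟨⟨hsub, -⟩, hxW⟩, -⟩; exact Finset.subset_erase.mpr ⟨hsub, hxW⟩
            · intro hsub
              refine ⟨⟨⟨(Finset.subset_erase.mp hsub).1, ?_⟩, (Finset.subset_erase.mp hsub).2⟩, fun h' => hnT ((hTmem W).mp h')⟩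
              calc W.card ≤ (V.erase x).card := Finset.card_le_card hsub
                _ = m := hV'
                _ ≤ a := by omega
          · rw [mem_dballF_of_notMem hcV' hcW]
            constructor
            · rintro ⟨⟨⟨hsub, hcard⟩, hxW⟩, -⟩; exact ⟨Finset.subset_erase.mpr ⟨hsub, hxW⟩, hcard⟩
            · rintro ⟨hsub, hcard⟩
              exact ⟨⟨⟨(Finset.subset_erase.mp hsub).1, hcard⟩, (Finset.subset_erase.mp hsub).2⟩, fun h' => hnT ((hTmem W).mp h')⟩
      have h1fam : ((F.filter (fun W => x ∈ W)).image (fun W => W.erase x)) ∪ T = dballF (V.erase x) c (a - 1) b := by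
        ext W
        rw [Finset.mem_union, Finset.mem_image, hTmem]
        by_cases hcW : c ∈ W
        · rw [mem_dballF_of_mem hcV' hcW]
          constructor
          · rintro (⟨W', hW', rfl⟩ | ⟨-, hsub, hcard⟩)
            · rw [Finset.mem_filter, hF] at hW'
              have hcW' : c ∈ W' := by
                have := hcW; rw [Finset.mem_erase] at this; exact this.2
              obtain ⟨hsub, hcard⟩ := (mem_dballF_of_mem hc hcW').mp hW'.1
              refine ⟨fun y hy => ?_, ?_⟩
              · rw [Finset.erase_right_comm] at hy
                exact Finset.mem_erase.mpr ⟨(Finset.mem_erase.mp hy).1, hsub (Finset.mem_of_mem_erase hy)⟩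
              · rw [Finset.erase_right_comm, Finset.card_erase_of_mem (Finset.mem_erase.mpr ⟨hxc, hW'.2⟩)]
                omega
            · exact ⟨hsub, hcard.le⟩
          · rintro ⟨hsub, hcard⟩
            by_cases hcb : (W.erase c).card = b
            · exact Or.inr ⟨hcW, hsub, hcb⟩
            · left
              have hxW : x ∉ W := fun hxW => Finset.notMem_erase x V (hsub (Finset.mem_erase.mpr ⟨hxc, hxW⟩))
              refine ⟨insert x W, Finset.mem_filter.mpr ⟨?_, Finset.mem_insert_self x W⟩, Finset.erase_insert hxW⟩
              rw [hF, mem_dballF_of_mem hc (Finset.mem_insert_of_mem hcW), Finset.erase_insert_of_ne hxc,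
                Finset.card_insert_of_notMem (fun hmem => hxW (Finset.mem_of_mem_erase hmem))]
              exact ⟨Finset.insert_subset hx (fun y hy => Finset.mem_of_mem_erase (hsub hy)), by omega⟩
        · rw [mem_dballF_of_notMem hcV' hcW]
          constructor
          · rintro (⟨W', hW', rfl⟩ | ⟨hcW', -, -⟩)
            · rw [Finset.mem_filter, hF] at hW'
              have hcW' : c ∉ W' := fun hmem => hcW (Finset.mem_erase.mpr ⟨hxc.symm, hmem⟩)
              obtain ⟨hsub, hcard⟩ := (mem_dballF_of_notMem hc hcW').mp hW'.1
              refine ⟨Finset.erase_subset_erase x hsub, ?_⟩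
              rw [Finset.card_erase_of_mem hW'.2]; omega
            · exact absurd hcW' hcW
          · rintro ⟨hsub, hcard⟩
            left
            have hxW : x ∉ W := (Finset.subset_erase.mp hsub).2
            refine ⟨insert x W, Finset.mem_filter.mpr ⟨?_, Finset.mem_insert_self x W⟩, Finset.erase_insert hxW⟩
            rw [hF, mem_dballF_of_notMem hc (by rw [Finset.mem_insert]; exact fun h' => h'.elim (fun heq => hxc heq.symm) hcW),
              Finset.card_insert_of_notMem hxW]
            exact ⟨Finset.insert_subset hx (Finset.subset_erase.mp hsub).1, by omega⟩
      refine ApexDecomp.step (vs := x) (G₁ := {c}) (T := T) (Finset.notMem_erase n X) hTF hTG hTL hcov ?_ ?_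
      · rw [h0fam]
        split_ifs with hb0
        · exact apexDecomp_powerset m (V.erase x) (X.erase n) hV' hX'
        · exact ih (V.erase x) (X.erase n) c a (b - 1) hcV' hV' hX' (by omega) (by omega)
      · rw [h1fam]
        exact ih (V.erase x) (X.erase n) c (a - 1) b hcV' hV' hX' (by omega) (by omega)

/-! ## 4. The profile-1 hit for cube-versus-double-ball pairs -/

/-- **Cube rows against double-ball columns are hit at profile 1** (Lefschetz-free; includes the cube-versus-ball pairs `2^{[2k]}` vs `B(2k+1, ≤k)`). -/
theorem symbolicDet_one_ne_zero_dballF {X V : Finset (Fin h)} {c : Fin h} {a b : ℕ} (hc : c ∉ V) (hXV : X.card = V.card)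
    (hab : a + b + 1 = V.card) (hba : b ≤ a) {r : ℕ} (u w : Fin r → Finset (Fin h)) (hu : ∀ U, U ⊆ X → ∃ i, u i = U)
    (hw : Function.Injective w) (hwF : Finset.univ.image w = dballF V c a b) : symbolicDet 1 h r u w ≠ 0 :=
  symbolicDet_one_ne_zero_of_apexDecomp u w hu hw (hwF ▸ apexDecomp_dballF V.card V X c a b hc rfl hXV hab hba)

end

end Summit.ValiantsHypothesis.ValiantsHypothesis.Theorems.BarrierLever.AnchoredPeeling
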